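import Summits.Ventures.GridStability.Models.Chiang3PrintedPointConvergence
import Literature.MathematicalPhysics.PowerSystems.NonMinimumEquilibriumInstability
import HarnessLib

/-!
# GridStability/Models/Chiang3PrintedUEPUnstable — «#155-cand G1.a′-CHIANG3-UEP-UNSTABLE-THM» (lead g9 RULING 9cv (2)(b)): FIVE OF THE SIX equilibrium points per period of
# Chiang's PRINTED three-machine system (4.1) are UNSTABLE rest points (energy route: a kernel-certified negative Hessian
# direction of the potential on each non-s.e.p. census box + isolation from the kernel census)

Statements, certificate data and proofs PREPARED BY gridfusion-lit-1 g11 (template `HOME/lean/lit-1/templates/Chiang3PrintedUEPUnstable.lean`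
8eb10d74883c3076), filed UNCHANGED by gridfusion-model-1 g8 (Summits side = the model seat's; the object `Chiang3.printedSystem` is model-1's p568246).

Ingredients (all on tree): model-1 `Models/Chiang3PrintedPointConvergence.lean` (p568246: `printedSystem : LosslessSystem 2 1` =
(4.1) verbatim, `printedSystem_isEquilibrium_iff`, `printedSystem_C_symm/_M_pos/_D_pos`, `printedSystem_finite_equilibria`);
lit-1 `Literature/…/ChiangThreeMachineEquilibriumCensus.lean` (p566261: the six certified leaf boxes `leafLo/leafHi/leafBox`,
`existsUnique_leaf`, `equilibria_eq_leafZeros` — leaf 0 = the s.e.p. box `[0, 0.197] × [0, 0.394]`); lit-1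
`Literature/…/NonMinimumEquilibriumInstability.lean` (p578908: `LosslessSystem.not_isLocalMin_potential_of_hessForm_neg`,
`LosslessSystem.unstable_of_not_isLocalMin_of_finite`); the code-list interval evaluator `FExpr.evalBox` / `evalBox_sound`
(`Literature/Analysis/ODE/CodeListMeanValueExtension.lean`).
THE CERTIFICATE: for each non-s.e.p. leaf box `B_j` (j = 1..5) a rational direction `v_j ∈ {(0,1), (1,0), (1,1)}` and ONE
interval evaluation showing `Q_j(θ) := ½ cos(θ₀ − θ₁)(v₀ − v₁)² + cos θ₀·v₀² + ½ cos θ₁·v₁² < 0` for ALL `θ ∈ B_j`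
(`Q_j` = the Hessian quadratic form `vᵀ ∇²U(θ) v` of the potential of (4.1); upper bounds ≈ −0.98, −1.48, −1.49, −1.10,
−0.85). [cite: Chiang1995, §4.1 eq. (4.1) and Table 4.1; ManikTimmeWitthaut2017, §3 Lemma 1, §5.2 proof of Cor. 2]
THREE COLUMNS: CERTIFIED for MODEL (4.1) as printed (lossless classical 3-machine system, machine 3 reference, unit inertias,
dampings 0.4/0.5): every equilibrium angle pair in the census boxes 1–5 — i.e. every equilibrium of the period box `[−π, π]²`
other than the s.e.p. `z₀ ≈ (0.020, 0.060)` — gives a Lyapunov-UNSTABLE rest point `(θe, 0)` (∃ ε ∀ δ: a rest state within δ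
whose every forward motion leaves the ε-ball); VALIDATED: Table 4.1's «type-one / type-two» labels are SPECTRAL and are NOT
certified by this route (the energy route does not count unstable eigenvalues); MODELLED: the printed model; «unstable» = the
rest point of MODEL (4.1), never a grid.
-/

noncomputable section

set_option autoImplicit false

open Set Filter Topology NonemptyInterval Matrix
open Literature.Analysis.ODE Literature.Analysis.ODE.FExpr
open Literature.Analysis.ValidatedNumerics
open Literature.MathematicalPhysics.PowerSystems
open Literature.MathematicalPhysics.PowerSystems.ChiangThreeMachine

namespace Summit.Ventures.GridStability.Models

namespace Chiang3

/-! ### §1. The five Hessian-direction certificates (one interval evaluation per non-s.e.p. box) -/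

/-- Test directions `v_j` (j = 0 unused; j = 1: (0,1); j = 2, 4, 5: (1,0); j = 3: (1,1)). -/
def dir : Fin 6 → Fin 2 → ℚ := ![![1, 0], ![0, 1], ![1, 0], ![1, 1], ![1, 0], ![1, 0]]

/-- The Hessian quadratic form of the potential of (4.1) in the direction `v_j`, as a code list in `(θ₀, θ₁) = (x 0, x 1)`:
`½ cos(θ₀ − θ₁)(v₀ − v₁)² + cos θ₀·v₀² + ½ cos θ₁·v₁²`. -/
def hessExpr (j : Fin 6) : FExpr 2 :=
  add (add (smul (1 / 2 * (dir j 0 - dir j 1) ^ 2) (cos (sub (var 0) (var 1))))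
    (smul (dir j 0 ^ 2) (cos (var 0))))
    (smul (1 / 2 * dir j 1 ^ 2) (cos (var 1)))

/-- The code list denotes the form. -/
theorem eval_hessExpr (j : Fin 6) (x : Fin 2 → ℝ) :
    (hessExpr j).eval x = 1 / 2 * ((dir j 0 : ℝ) - dir j 1) ^ 2 * Real.cos (x 0 - x 1)
      + (dir j 0 : ℝ) ^ 2 * Real.cos (x 0) + 1 / 2 * (dir j 1 : ℝ) ^ 2 * Real.cos (x 1) := by
  simp only [hessExpr, eval]
  push_cast
  ring

/-- THE CERTIFICATE: on each of the five non-s.e.p. leaf boxes the interval evaluation of the form has a NEGATIVE upper end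
(kernel `decide`; natural interval extension with the tree's `searchCfg`). -/
def hessNeg (j : Fin 6) : Bool :=
  match evalBox searchCfg (hessExpr j) (leafBox j) with
  | some I => decide (I.snd < 0)
  | none => false

/-- **KERNEL: the Hessian-direction certificate passes on every non-s.e.p. census box** (`j = 1 … 5`): ONE interval evaluation
of `Q_j` per box, upper end `< 0` (kernel intervals ≈ j=1 (−1.104, −0.895), j=2 (−1.530, −1.437), j=3 (−1.543, −1.438), j=4
(−1.156, −1.065), j=5 (−1.027, −0.782); box 0, the s.e.p., gives a POSITIVE form — the certificate's teeth). -/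
theorem hessNeg_all : ∀ j : Fin 6, j ≠ 0 → hessNeg j = true := by decide +kernel

/-- Soundness: on the non-s.e.p. boxes the Hessian form in the direction `v_j` is negative. -/
theorem hessForm_neg {j : Fin 6} (hj : j ≠ 0) {x : Fin 2 → ℝ}
    (hx : ((leafLo j 0 : ℝ) ≤ x 0 ∧ x 0 ≤ leafHi j 0) ∧ ((leafLo j 1 : ℝ) ≤ x 1 ∧ x 1 ≤ leafHi j 1)) :
    (hessExpr j).eval x < 0 := by
  have h := hessNeg_all j hj
  unfold hessNeg at h
  cases hI : evalBox searchCfg (hessExpr j) (leafBox j) with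
  | none => rw [hI] at h; exact absurd h (by decide)
  | some I =>
    rw [hI] at h
    have hlt : I.snd < 0 := of_decide_eq_true h
    have hxB : x ∈ boxSet (castBox (leafBox j)) := by
      rw [mem_boxSet_iff, Fin.forall_fin_two]
      simp only [leafBox, castBox_apply, mem_ratCast_iff]
      exact hx
    have hmem := (evalBox_sound hI hxB).2
    rw [mem_ratCast_iff] at hmem
    calc (hessExpr j).eval x ≤ (I.snd : ℝ) := hmem.2
      _ < 0 := by exact_mod_cast hlt

/-- The printed system's Hessian quadratic form IS the code list's value (machine–machine `C₀₁ = C₁₀ = ½`, bus couplings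
`K = (1, ½)`, bus angle 0). -/
theorem printedSystem_hessForm_eq (j : Fin 6) (θ : Fin 2 → ℝ) :
    1 / 2 * ∑ i, ∑ k, printedSystem.C i k * Real.cos (θ i - θ k) *
        ((fun i => (dir j i : ℝ)) i - (fun i => (dir j i : ℝ)) k) ^ 2
      + ∑ i, ∑ b, printedSystem.K i b * Real.cos (θ i - printedSystem.β b) * (fun i => (dir j i : ℝ)) i ^ 2
      = (hessExpr j).eval θ := by
  rw [eval_hessExpr]
  simp only [printedSystem, Fin.sum_univ_two, Fin.sum_univ_one, Fin.isValue, Matrix.cons_val_zero,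
    Matrix.cons_val_one, if_true, one_ne_zero, zero_ne_one, if_false, sub_zero, sub_self, Real.cos_zero]
  have hc : Real.cos (θ 1 - θ 0) = Real.cos (θ 0 - θ 1) := by rw [← Real.cos_neg]; ring_nf
  rw [hc]
  ring

/-! ### §2. Five of the six equilibrium points are unstable rest points -/

/-- ★ **EVERY EQUILIBRIUM IN A NON-S.E.P. CENSUS BOX IS AN UNSTABLE REST POINT of the printed system (4.1)**: for
`j ∈ {1, …, 5}` and every solution `θe` of the printed power balance inside leaf box `j` (there is exactly one,
`existsUnique_leaf`), `∃ ε > 0 ∀ δ > 0 ∃ x₁` with `dist(x₁, (θe, 0)) < δ` such that EVERY forward motion of (4.1) from `x₁`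
reaches `dist(X(t), (θe, 0)) > ε` (energy route: `vⱼᵀ∇²U vⱼ < 0` on the box ⇒ `U` not a local minimum at `θe`; isolation from the
kernel census). [cite: Chiang1995, §4.1; ManikTimmeWitthaut2017, §3 Lemma 1] -/
theorem printed_unstable_of_mem_leafBox {j : Fin 6} (hj : j ≠ 0) {θe : Fin 2 → ℝ}
    (hbox : ((leafLo j 0 : ℝ) ≤ θe 0 ∧ θe 0 ≤ leafHi j 0) ∧ ((leafLo j 1 : ℝ) ≤ θe 1 ∧ θe 1 ≤ leafHi j 1))
    (he : printedSystem.IsEquilibrium θe) :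
    ∃ ε > 0, ∀ δ > 0, ∃ x₁ : (Fin 2 → ℝ) × (Fin 2 → ℝ), dist x₁ (θe, 0) < δ ∧
      ∀ X : ℝ → (Fin 2 → ℝ) × (Fin 2 → ℝ), X 0 = x₁ →
        (∀ T : ℝ, ∀ t ∈ Icc 0 T, HasDerivWithinAt X (printedSystem.field (X t)) (Icc 0 T) t) →
        ∃ t, 0 ≤ t ∧ ε < dist (X t) (θe, 0) := by
  have hv : 1 / 2 * ∑ i, ∑ k, printedSystem.C i k * Real.cos (θe i - θe k) *
        ((fun i => (dir j i : ℝ)) i - (fun i => (dir j i : ℝ)) k) ^ 2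
      + ∑ i, ∑ b, printedSystem.K i b * Real.cos (θe i - printedSystem.β b) * (fun i => (dir j i : ℝ)) i ^ 2 < 0 := by
    rw [printedSystem_hessForm_eq]
    exact hessForm_neg hj hbox
  exact printedSystem.unstable_of_not_isLocalMin_of_finite printedSystem_C_symm printedSystem_M_pos
    printedSystem_D_pos printedSystem_finite_equilibria he
    (printedSystem.not_isLocalMin_potential_of_hessForm_neg printedSystem_C_symm he _ hv)

/-- ★★ **FIVE OF THE SIX EQUILIBRIUM POINTS PER PERIOD OF CHIANG'S PRINTED (4.1) ARE UNSTABLE REST POINTS**: every solution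
`θe` of the printed power balance with `|θe₀|, |θe₁| ≤ π` OUTSIDE the s.e.p. box `[0, 63/320] × [0, 63/160]` gives an unstable
rest point `(θe, 0)`; by the census (`equilibria_eq_leafZeros`) these are exactly the five points `z₁, …, z₅` (Table 4.1's
type-one/type-two points modulo 2π, their spectral types NOT certified here); the sixth, `z₀ = θˢ ≈ (0.020, 0.060)`, is
★ #133 / ★ #139's attracting equilibrium. [cite: Chiang1995, §4.1 Table 4.1] -/
theorem printed_unstable_of_not_mem_sepBox {θe : Fin 2 → ℝ} (hπ : |θe 0| ≤ Real.pi ∧ |θe 1| ≤ Real.pi)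
    (he : printedSystem.IsEquilibrium θe)
    (hout : ¬ (((leafLo 0 0 : ℝ) ≤ θe 0 ∧ θe 0 ≤ leafHi 0 0) ∧ ((leafLo 0 1 : ℝ) ≤ θe 1 ∧ θe 1 ≤ leafHi 0 1))) :
    ∃ ε > 0, ∀ δ > 0, ∃ x₁ : (Fin 2 → ℝ) × (Fin 2 → ℝ), dist x₁ (θe, 0) < δ ∧
      ∀ X : ℝ → (Fin 2 → ℝ) × (Fin 2 → ℝ), X 0 = x₁ →
        (∀ T : ℝ, ∀ t ∈ Icc 0 T, HasDerivWithinAt X (printedSystem.field (X t)) (Icc 0 T) t) →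
        ∃ t, 0 ≤ t ∧ ε < dist (X t) (θe, 0) := by
  obtain ⟨z, -, hz, hall⟩ := equilibria_eq_leafZeros
  have he' : ChiangThreeMachine.IsEquilibrium (θe 0, θe 1) := (printedSystem_isEquilibrium_iff θe).1 he
  obtain ⟨j, hj⟩ := (hall (θe 0, θe 1)).1 ⟨hπ, he'⟩
  have hbox := (hz j).1
  rw [← hj] at hbox
  have hj0 : j ≠ 0 := by
    rintro rfl
    exact hout hbox
  exact printed_unstable_of_mem_leafBox hj0 hbox he

end Chiang3

end Summit.Ventures.GridStability.Models

end
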